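import Mathlib
import Literature.Computability.AlgebraicComplexity.RealTauKnownCases
import Literature.Computability.AlgebraicComplexity.MignonRessayreBound
import Summits.ValiantsHypothesis.ValiantsHypothesis.Theorems.LacunarySymmetroidMatrixDescartesStubNegRoots
import Summits.ValiantsHypothesis.ValiantsHypothesis.Theorems.LacunarySymmetroidMatrixDescartesCommonDirectionFactor

/-!
# `MatrixDescartes` (stmt-ValiantsHypothesis-18050) — the COMMON-DIRECTION LOW-RANK SECTOR, part 2: a size-free
# ceiling for pencils whose letters are `cₗ • B + Wₗ` (ONE common matrix `B`, low-rank `Wₗ`), and the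
# crux's inequality on that format family at every size

HONEST FRAMING.  Cell `pub-symmetroid`, seat `val-sym-mdr-p2` (gen 18); helper file `--supports` the crux
`Theses.LacunarySymmetroid.MatrixDescartes`.  It proves the crux's inequality `Z^q ≤ 2^(K⌊log₂K⌋)` on ONE
structural format family (every size `m`, every exponent table, no symmetry needed) and decides nothing about
the crux in its window `K^(1+o(1)) ≤ m ≤ 2^(polylog K)` for unrestricted letters, nothing about the cell's
registers `DoorA26` / `DoorA34`, and nothing about `VP ≠ VNP`.

THE SECTOR.  Letters `Sₗ = cₗ • B + Wₗ` (`l < K`): a COMMON real `m × m` matrix `B` (any rank, not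
necessarily symmetric or invertible) carried by an arbitrary `K`-nomial `φ = ∑ₗ cₗ X^{dₗ}`, plus perturbations
`Wₗ` of ranks `ρₗ`, `R := ∑ₗ ρₗ`.  Every letter may have full rank.  THEN (`commonDirection_ceiling`)

  `Z₊ + 1 ≤ (K − 1) + (∏ₗ (ρₗ + 1)) · C(R + K − 1, K − 1)`,

uniformly in the size `m`, where `Z₊` is the number of distinct positive zeros of `det (∑ₗ X^{dₗ} Sₗ)`
(`commonDirection_ceiling_uniform`: `≤ (K − 1) + (ρ+1)^K · C(ρK + K − 1, K − 1)` when all `ρₗ ≤ ρ`).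
The tree's low-rank sector (`lowRankCeiling`, `…LowRankSector`: `Z₊ + 1 ≤ ∏_{l ≠ l₀} (rank Sₗ + 1)`) is the
case `cₗ = 0` for `l ≠ l₀`, `B = S_{l₀}`, `W_{l₀} = 0`; here ALL letters carry the fat direction `B`
(e.g. `Sₗ = cₗ • 1 + εₗ vₗvₗᵀ`, «isotropic plus rank one»: `Z₊ ≤ K − 2 + 2^K · C(2K − 1, K − 1)` at every size).
Consequently (`commonDirection_mdr`, `commonDirection_eventually`): for all `q, s` and every `K` with
`q·(2^s + s + 2) ≤ ⌊log₂K⌋`, ALL sizes `m`, all exponents, every real `B`, all reals `cₗ` and all `Wₗ` of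
rank `< 2^s`, `Z^q ≤ 2^(K⌊log₂K⌋)` for the number `Z` of distinct real zeros — the quantifier shape of the
crux (`K₀ = 2^(q(2^s+s+2))`, every `c`, no size bound) on a format family outside the census table.

PROOF.  Part 1 (`…CommonDirectionFactor`, namespace `CommonDirection`): `det F = φ^(m−R) · h` with
`#supp h ≤ ∏(rank Wₗ+1)·C(R+K−1, K−1)` and `Z₊(φ^N) ≤ K − 1`.  Here: a nonzero real polynomial has fewer
distinct positive zeros than monomials (tree `card_roots_toFinset_filter_pos_lt_card_support`),
`roots (φ^(m−R) · h) = roots ∪ roots`; for all real zeros add the reflected pencil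
`Sₗ ↦ (−1)^{dₗ} Sₗ = ((−1)^{dₗ}cₗ) • B + (−1)^{dₗ} Wₗ` (same sector, same ranks, tree `rank_smul_le`) and the origin
(tree `stub_negRoots`); the exponent arithmetic is `(K − 1) + (2^s)^K · C((2^s−1)K + K − 1, K − 1) ≤ 2^((2^s+s+1)K)`
(`ceiling_le_two_pow`).  Elementary; axioms `propext`, `Classical.choice`, `Quot.sound`.
-/

-- layout Summits/ValiantsHypothesis/ValiantsHypothesis forces the duplicated namespace component
set_option linter.dupNamespace false

namespace Summit.ValiantsHypothesis.ValiantsHypothesis.Theorems.LacunarySymmetroidMatrixDescartes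

open Polynomial Finset
open scoped BigOperators Polynomial

/-- the scalar `K`-nomial `φ = ∑ₗ C(cₗ) X^{dₗ}` carrying the common direction (file-local notation, as in part 1) -/
local notation3 (prettyPrint := false) "φ[" d ", " c "]" =>
  (∑ l, Polynomial.C (c l) * (Polynomial.X : Polynomial ℝ) ^ (d l))

/-- the cofactor `h` of `det F = φ^(m − R) · h` (file-local notation, as in part 1) -/
local notation3 (prettyPrint := false) "hP[" m ", " d ", " B ", " c ", " W "]" =>
  (∑ g : Fin m → Option (Fin _),
    φ[d, c] ^ ((Finset.univ.filter fun i => g i = none).card - (m - ∑ l, (W l).rank))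
      * (Polynomial.X : Polynomial ℝ) ^ (∑ i, (g i).elim 0 d)
      * Polynomial.C (Matrix.det (Matrix.of fun i j => Option.elim (g i) B W i j)))

/-- **COMMON-DIRECTION CEILING (size-free).**  For every `K ≥ 1`, every size `m`, all exponents `d`, every
real `m × m` matrix `B`, all reals `cₗ` and all real `m × m` matrices `Wₗ`, the lacunary pencil
`∑ₗ X^{dₗ} (cₗ • B + Wₗ)` — every letter a multiple of ONE common matrix plus a perturbation — satisfies
`Z₊ + 1 ≤ (K − 1) + (∏ₗ (rank Wₗ + 1)) · C(∑ₗ rank Wₗ + K − 1, K − 1)` for the number `Z₊` of distinct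
positive zeros of its determinant, independently of the size `m`.  (The determinant `0` has no counted
roots.)  Contains the low-rank ceiling's sector (`cₗ = 0` off a pivot). [folklore] -/
theorem commonDirection_ceiling {K m : ℕ} (hK : 0 < K) (d : Fin K → ℕ) (B : Matrix (Fin m) (Fin m) ℝ)
    (c : Fin K → ℝ) (W : Fin K → Matrix (Fin m) (Fin m) ℝ) :
    ((Matrix.det (∑ l, ((Polynomial.X : Polynomial ℝ) ^ d l) • (c l • B + W l).map Polynomial.C)
        ).roots.toFinset.filter (fun t => 0 < t)).card + 1
      ≤ (K - 1) + (∏ l, ((W l).rank + 1)) * Nat.choose ((∑ l, (W l).rank) + K - 1) (K - 1) := by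
  have hprod : 1 ≤ (∏ l, ((W l).rank + 1)) * Nat.choose ((∑ l, (W l).rank) + K - 1) (K - 1) :=
    Nat.one_le_iff_ne_zero.2 (Nat.mul_ne_zero (Finset.prod_ne_zero_iff.2 fun l _ => Nat.succ_ne_zero _)
      (Nat.pos_iff_ne_zero.1 (Nat.choose_pos (by omega))))
  by_cases hP : Matrix.det (∑ l, ((Polynomial.X : Polynomial ℝ) ^ d l) • (c l • B + W l).map Polynomial.C)
      = 0
  · rw [hP, Polynomial.roots_zero, Multiset.toFinset_zero, Finset.filter_empty, Finset.card_empty,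
      zero_add]
    omega
  · rw [CommonDirection.det_pencil_eq_mul] at hP ⊢
    have hφ : φ[d, c] ^ (m - ∑ l, (W l).rank) ≠ 0 := left_ne_zero_of_mul hP
    have hh : hP[m, d, B, c, W] ≠ 0 := right_ne_zero_of_mul hP
    rw [Polynomial.roots_mul hP, Multiset.toFinset_add, Finset.filter_union]
    have h1 := CommonDirection.card_posRoots_phi_pow_le hK d c _ hφ
    have h2 :=
      Literature.Computability.AlgebraicComplexity.card_roots_toFinset_filter_pos_lt_card_support hh
    have h3 := CommonDirection.card_support_h_le hK d B c W
    calc ((φ[d, c] ^ (m - ∑ l, (W l).rank)).roots.toFinset.filter (fun t => 0 < t) ∪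
            (hP[m, d, B, c, W]).roots.toFinset.filter (fun t => 0 < t)).card + 1
        ≤ (((φ[d, c] ^ (m - ∑ l, (W l).rank)).roots.toFinset.filter (fun t => 0 < t)).card +
            ((hP[m, d, B, c, W]).roots.toFinset.filter (fun t => 0 < t)).card) + 1 :=
          Nat.add_le_add_right (Finset.card_union_le _ _) 1
      _ ≤ (K - 1) + (∏ l, ((W l).rank + 1)) * Nat.choose ((∑ l, (W l).rank) + K - 1) (K - 1) := by
          omega

/-- **Common-direction ceiling, uniform form**: if every perturbation has rank `≤ ρ` then
`Z₊ + 1 ≤ (K − 1) + (ρ+1)^K · C(ρK + K − 1, K − 1)`, for every size `m`. [folklore] -/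
theorem commonDirection_ceiling_uniform {K m : ℕ} (hK : 0 < K) (ρ : ℕ) (d : Fin K → ℕ)
    (B : Matrix (Fin m) (Fin m) ℝ) (c : Fin K → ℝ) (W : Fin K → Matrix (Fin m) (Fin m) ℝ)
    (hρ : ∀ l, (W l).rank ≤ ρ) :
    ((Matrix.det (∑ l, ((Polynomial.X : Polynomial ℝ) ^ d l) • (c l • B + W l).map Polynomial.C)
        ).roots.toFinset.filter (fun t => 0 < t)).card + 1
      ≤ (K - 1) + (ρ + 1) ^ K * Nat.choose (ρ * K + K - 1) (K - 1) := by
  refine (commonDirection_ceiling hK d B c W).trans (Nat.add_le_add_left ?_ _)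
  have hp : ∏ l, ((W l).rank + 1) ≤ (ρ + 1) ^ K := by
    calc ∏ l, ((W l).rank + 1) ≤ ∏ _l : Fin K, (ρ + 1) :=
          Finset.prod_le_prod' fun l _ => Nat.add_le_add_right (hρ l) 1
      _ = (ρ + 1) ^ K := by rw [Finset.prod_const, Finset.card_univ, Fintype.card_fin]
  have hs : ∑ l, (W l).rank ≤ ρ * K := by
    calc ∑ l, (W l).rank ≤ ∑ _l : Fin K, ρ := Finset.sum_le_sum fun l _ => hρ l
      _ = ρ * K := by rw [Finset.sum_const, Finset.card_univ, Fintype.card_fin, smul_eq_mul, mul_comm]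
  exact Nat.mul_le_mul hp (Nat.choose_le_choose _ (by omega))

/-- Arithmetic of the uniform ceiling: with ranks `< 2^s`,
`(K − 1) + (2^s)^K · C((2^s − 1)K + K − 1, K − 1) ≤ 2^((2^s + s + 1)·K)`. [folklore] -/
theorem ceiling_le_two_pow (K s : ℕ) :
    (K - 1) + (2 ^ s - 1 + 1) ^ K * Nat.choose ((2 ^ s - 1) * K + K - 1) (K - 1)
      ≤ 2 ^ ((2 ^ s + s + 1) * K) := by
  have h2s : 2 ^ s - 1 + 1 = 2 ^ s := Nat.sub_add_cancel Nat.one_le_two_pow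
  rw [h2s]
  set A := 2 ^ ((2 ^ s + s) * K) with hA
  have hX : (2 ^ s) ^ K * Nat.choose ((2 ^ s - 1) * K + K - 1) (K - 1) ≤ A := by
    have hC : Nat.choose ((2 ^ s - 1) * K + K - 1) (K - 1) ≤ 2 ^ (2 ^ s * K) := by
      refine (Nat.choose_le_two_pow _ _).trans (Nat.pow_le_pow_right (by norm_num) ?_)
      have : (2 ^ s - 1) * K + K = 2 ^ s * K := by
        rw [← Nat.succ_mul, Nat.succ_eq_add_one, h2s]
      omega
    calc (2 ^ s) ^ K * Nat.choose ((2 ^ s - 1) * K + K - 1) (K - 1)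
        ≤ 2 ^ (s * K) * 2 ^ (2 ^ s * K) := by rw [← pow_mul]; exact Nat.mul_le_mul_left _ hC
      _ = A := by rw [hA, ← pow_add]; congr 1; ring
  have hA1 : 1 ≤ A := Nat.one_le_two_pow
  have h2K : 1 ≤ 2 ^ K := Nat.one_le_two_pow
  have hK1 : K - 1 ≤ (2 ^ K - 1) * A := by
    calc K - 1 ≤ 2 ^ K - 1 := Nat.sub_le_sub_right Nat.lt_two_pow_self.le 1
      _ = (2 ^ K - 1) * 1 := (mul_one _).symm
      _ ≤ (2 ^ K - 1) * A := Nat.mul_le_mul_left _ hA1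
  calc (K - 1) + (2 ^ s) ^ K * Nat.choose ((2 ^ s - 1) * K + K - 1) (K - 1)
      ≤ (2 ^ K - 1) * A + 1 * A := Nat.add_le_add hK1 (by rw [one_mul]; exact hX)
    _ = 2 ^ K * A := by rw [← Nat.add_mul, Nat.sub_add_cancel h2K]
    _ = 2 ^ ((2 ^ s + s + 1) * K) := by rw [hA, ← pow_add]; congr 1; ring

/-- **The crux's inequality on the common-direction sector.**  For all `q, s` and every `K` with
`q·(2^s + s + 2) ≤ ⌊log₂K⌋` (and `K ≥ 1`), EVERY size `m`, all exponents `d`, every real `m × m` matrix `B`, all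
reals `cₗ` and all real `m × m` matrices `Wₗ` of rank `< 2^s`, the number `Z` of distinct real zeros of
`det (∑ₗ X^{dₗ}(cₗ • B + Wₗ))` satisfies `Z^q ≤ 2^(K⌊log₂K⌋)` — the inequality of `MatrixDescartes`, here
without its size bound and without symmetry, on the format family «one common fat direction + low rank».
Proof: the positive zeros of the pencil and of its reflection `Sₗ ↦ (−1)^{dₗ}Sₗ = ((−1)^{dₗ}cₗ) • B + (−1)^{dₗ}Wₗ`
(same ranks, tree `rank_smul_le`) are each `< 2^((2^s+s+1)K)` by `commonDirection_ceiling_uniform` and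
`ceiling_le_two_pow`, plus the origin (tree `stub_negRoots`). [folklore] -/
theorem commonDirection_mdr (q s K m : ℕ) (hK : q * (2 ^ s + s + 2) ≤ Nat.log 2 K) (hK0 : 0 < K)
    (d : Fin K → ℕ) (B : Matrix (Fin m) (Fin m) ℝ) (c : Fin K → ℝ)
    (W : Fin K → Matrix (Fin m) (Fin m) ℝ) (hr : ∀ l, (W l).rank < 2 ^ s) :
    (Matrix.det (∑ l, ((Polynomial.X : Polynomial ℝ) ^ d l) •
        (c l • B + W l).map Polynomial.C)).roots.toFinset.card ^ q ≤ 2 ^ (K * Nat.log 2 K) := by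
  have hr' : ∀ l, ((((-1 : ℝ) ^ d l) • W l)).rank ≤ 2 ^ s - 1 := fun l =>
    (Literature.Computability.AlgebraicComplexity.rank_smul_le _ _).trans (Nat.le_sub_one_of_lt (hr l))
  have hA := commonDirection_ceiling_uniform hK0 (2 ^ s - 1) d B c W
    (fun l => Nat.le_sub_one_of_lt (hr l))
  have hB := commonDirection_ceiling_uniform hK0 (2 ^ s - 1) d B (fun l => (-1 : ℝ) ^ d l * c l)
    (fun l => ((-1 : ℝ) ^ d l) • W l) hr'
  have hT := ceiling_le_two_pow K s
  have hZ := stub_negRoots K m d (fun l => c l • B + W l)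
  have hreflsum : (∑ l, ((Polynomial.X : Polynomial ℝ) ^ d l) •
        (((-1 : ℝ) ^ d l) • (c l • B + W l)).map Polynomial.C)
      = ∑ l, ((Polynomial.X : Polynomial ℝ) ^ d l) •
        (((-1 : ℝ) ^ d l * c l) • B + ((-1 : ℝ) ^ d l) • W l).map Polynomial.C := by
    refine Finset.sum_congr rfl fun l _ => ?_
    rw [smul_add, smul_smul]
  rw [hreflsum] at hZ
  have hZle : (Matrix.det (∑ l, ((Polynomial.X : Polynomial ℝ) ^ d l) •
      (c l • B + W l).map Polynomial.C)).roots.toFinset.card ≤ 2 ^ ((2 ^ s + s + 1) * K + 1) := by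
    rw [pow_succ]
    omega
  have hexp : ((2 ^ s + s + 1) * K + 1) * q ≤ K * Nat.log 2 K := by
    have h1 : ((2 ^ s + s + 1) * K + 1) * q ≤ (q * (2 ^ s + s + 2)) * K := by
      have : (2 ^ s + s + 1) * K + 1 ≤ (2 ^ s + s + 2) * K := by nlinarith
      nlinarith
    exact h1.trans (by rw [mul_comm]; exact Nat.mul_le_mul_left _ hK)
  calc (Matrix.det (∑ l, ((Polynomial.X : Polynomial ℝ) ^ d l) •
          (c l • B + W l).map Polynomial.C)).roots.toFinset.card ^ q
        ≤ (2 ^ ((2 ^ s + s + 1) * K + 1)) ^ q := Nat.pow_le_pow_left hZle q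
    _ = 2 ^ (((2 ^ s + s + 1) * K + 1) * q) := by rw [← pow_mul]
    _ ≤ 2 ^ (K * Nat.log 2 K) := Nat.pow_le_pow_right (by norm_num) hexp

/-- **The common-direction sector satisfies `MatrixDescartes` eventually in `K`, uniformly in the size**: for
all `q, s`, all `K ≥ 2^(q(2^s+s+2))`, ALL `m`, all exponents, every real `B`, all reals `cₗ` and all real
`Wₗ` of rank `< 2^s`, `Z^q ≤ 2^(K⌊log₂K⌋)`.  This is the quantifier shape of the crux (`K₀ = 2^(q(2^s+s+2))`,
every `c`) restricted to one format family outside the census table; it says nothing about letters whose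
fat parts are not proportional to one matrix. [folklore] -/
theorem commonDirection_eventually (q s : ℕ) :
    ∀ K m : ℕ, 2 ^ (q * (2 ^ s + s + 2)) ≤ K →
      ∀ (d : Fin K → ℕ) (B : Matrix (Fin m) (Fin m) ℝ) (c : Fin K → ℝ)
        (W : Fin K → Matrix (Fin m) (Fin m) ℝ), (∀ l, (W l).rank < 2 ^ s) →
      (Matrix.det (∑ l, ((Polynomial.X : Polynomial ℝ) ^ d l) •
          (c l • B + W l).map Polynomial.C)).roots.toFinset.card ^ q ≤ 2 ^ (K * Nat.log 2 K) :=
  fun K m hK d B c W hr =>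
    commonDirection_mdr q s K m (Nat.le_log_of_pow_le (by norm_num) hK)
      (Nat.one_le_two_pow.trans hK) d B c W hr

end Summit.ValiantsHypothesis.ValiantsHypothesis.Theorems.LacunarySymmetroidMatrixDescartes
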